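import Literature.AlgebraicGeometry.Motives.SummitCompatible
import Literature.AlgebraicGeometry.Motives.WeilCohomologyProofs
import Literature.AlgebraicGeometry.HodgeTheory.HyperplaneClassHardLefschetzPullback
import Literature.AlgebraicTopology.SingularHomology.IntegralClassRingChange
import Literature.AlgebraicTopology.SingularHomology.CupProductProofs
import HarnessLib

/-!
# Hard Lefschetz for the Weil cohomology of EVERY Betti–Hodge realization datum over `ℂ`

For a Betti–Hodge realization datum `B` over `ℂ` (`BettiHodgeData ℂ`: a Weil cohomology `B.W` with
`ℚ`-coefficients together with a natural multiplicative comparison `B.iso : Hⁱ_W ≅ Hⁱ(X(ℂ); ℚ)`), every smooth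
projective `X` of dimension `n`, every `W`-hyperplane class `η` and `i + r = n`, the iterated Lefschetz operator
`Lʳ = (· ∪ ηʳ) : Hⁱ_W(X) → Hⁱ⁺²ʳ_W(X)` is bijective — Voisin I, Thm. 6.25 (hard Lefschetz for the Kähler class of a
projective manifold), transported along the comparison:

1. `BettiHodgeData.toComplexBetti_cup`, `BettiHodgeData.toComplexBetti_pullback`: the complexified comparison
   `Φ = ι ∘ B.isoObj : Hⁱ_W(X) → Hⁱ(X(ℂ); ℚ) → Hⁱ(X(ℂ); ℂ)` is multiplicative (`B.iso_cup` and
   `singularCohomology.ringChange_cupProduct`) and natural (`B.isoObj_pullback` and `singularCohomology.ringChange_map`);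
   hence `BettiHodgeData.toComplexBetti_lefschetzPow`: `Φ ∘ Lʳ_η = Lʳ_{Φ η} ∘ Φ` (`W.cup_assoc` on the Weil side,
   graded commutativity `cupProduct_gradedComm_holds` on the singular side).
2. `BettiHodgeData.hasHardLefschetzProperty_toComplexBetti`: a `W`-hyperplane class is `η = e.ι^* cl_W(D)` for a
   closed immersion `e.ι : X ⟶ ℙᴺ` and an effective divisor `D > 0` of `ℙᴺ` (`PreWeilCohomology.IsHyperplaneClass`);
   for `n ≥ 1`, `tr_X(ηⁿ) = deg > 0` (`trace_pow_of_isHyperplaneClass`) forces `η ≠ 0`, so `Φ(cl_W D) ≠ 0` spans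
   the line `H²(ℙᴺ(ℂ); ℂ)` (`exists_isRationalClass_forall_eq_smul_projectiveSpace`, `b₂(ℙᴺ) = 1`), and
   `Φ η = e.ι(ℂ)^* Φ(cl_W D)` has the hard Lefschetz property in dimension `n` by
   `hasHardLefschetzProperty_map_of_forall_eq_smul` (Voisin I Thm. 6.25 for the Kähler class of `X ⊂ ℙᴺ`,
   invariant under non-zero scalars).
3. **`BettiHodgeData.hasHardLefschetz : B.W.HasHardLefschetz`**: injectivity of `Lʳ_η` (`r > 0`, so `n ≥ 1`)
   follows from that of `Lʳ_{Φ η} ∘ Φ` (`toComplexBetti_injective`), and injectivity is bijectivity by Poincaré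
   duality (`WeilCohomology.hasHardLefschetz_iff_injective_of_pos`).

No compatibility guard (`IsComparisonCompatible`, `IsClassicalHodge`) is needed: hard Lefschetz is twist-invariant.
This feeds the hypothesis `(hL : W.HasHardLefschetz)` of `Motives/StandardConjecturesSl2Proofs`, `Motives/MotivatedAut`,
`Motives/LefschetzStarExternalProduct`, … for every `B.W`, `B : BettiHodgeData ℂ`.

References: [VoisinHodgeI2002] Thm. 6.25, Rem. 6.27, Thm. 7.10, §7.1.1–7.1.2; [Kleiman1968] §1.2 (A), §1.4;
[HatcherAT2002] §3.1 p. 198, §3.2 Prop. 3.10, Thm. 3.11.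

Provenance: Literature home (namespace `Literature.AlgebraicGeometry.Motives.BettiHodgeData`, dot-notation on the
structure of `Motives/BettiRealization`) of the Summits-side `Theorems/PeriodsPoliceClassicalBridgeBettiHardLefschetz`
(`ClassicalBridge.bettiHardLefschetz`, whose imports are all `Literature/`), which `Literature/` may not import;
theorems only, no named fact, no definition. Lane `lit-hodgefound` (Layer A4 / B: Lefschetz theory of Betti
cohomology), seat p20.
-/

noncomputable section

open CategoryTheory _root_.AlgebraicGeometry
open Literature.AlgebraicGeometry.HodgeTheory
open Literature.AlgebraicTopology.SingularHomology Literature.Geometry.Kaehler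

namespace Literature.AlgebraicGeometry.Motives

namespace BettiHodgeData

variable (B : BettiHodgeData ℂ)

/-! ## The complexified comparison is multiplicative and natural -/

/-- **`Φ(a ∪ b) = Φ a ∪ Φ b`** for the complexified comparison `Φ = B.toComplexBetti = ι ∘ B.isoObj`
(`B.iso_cup`: the comparison carries `W.cup` to the singular cup product; `ringChange_cupProduct`: the change of
coefficients `ι : Hⁱ(X(ℂ); ℚ) → Hⁱ(X(ℂ); ℂ)` is multiplicative). [cite: HatcherAT2002, §3.2 p. 215]
[cite: Kleiman1968, §1.2 Example (1)] -/
theorem toComplexBetti_cup (X : SchemeOver ℂ) {p q m : ℕ} (h : p + q = m) (a : B.W.obj X p)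
    (b : B.W.obj X q) :
    B.toComplexBetti X m (B.W.cup h a b) =
      cupProduct h (B.toComplexBetti X p a) (B.toComplexBetti X q b) := by
  rw [BettiHodgeData.toComplexBetti_apply, BettiHodgeData.toComplexBetti_apply,
    BettiHodgeData.toComplexBetti_apply, BettiHodgeData.isoObj_apply, BettiHodgeData.isoObj_apply,
    BettiHodgeData.isoObj_apply, B.iso_cup X h a b]
  exact singularCohomology.ringChange_cupProduct _ h _ _

/-- **`Φ(f^* a) = f(ℂ)^* (Φ a)`**: the complexified comparison is natural in `X` (`B.isoObj_pullback`: `B.iso` is a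
natural isomorphism; `ringChange_map`: change of coefficients commutes with pull-backs). [cite: HatcherAT2002, §3.1 p. 198]
[cite: Kleiman1968, §1.2 Example (1)] -/
theorem toComplexBetti_pullback {X Y : SchemeOver ℂ} (f : X ⟶ Y) (i : ℕ) (a : B.W.obj Y i) :
    B.toComplexBetti X i (B.W.pullback f i a) =
      singularCohomology.map ℂ ℂ (AlgPoints.mapContinuous (L := ℂ) f) i (B.toComplexBetti Y i a) := by
  rw [BettiHodgeData.toComplexBetti_apply, BettiHodgeData.isoObj_pullback,
    BettiHodgeData.toComplexBetti_apply]
  exact singularCohomology.ringChange_map _ _ _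

variable {B} in
/-- **`Φ ∘ Lʳ_η = Lʳ_{Φ η} ∘ Φ`**: the complexified comparison intertwines the iterated Lefschetz operator
`Lʳ_η = (· ∪ ηʳ)` of `B.W` (Kleiman §1.4) with the tree's `lefschetzPowTo (Φ η) r = ((Φ η) ∪ ·)ʳ` on
`H•(X(ℂ); ℂ)` (Voisin I §6.2.3), for `X` smooth projective (associativity `W.cup_assoc` on the Weil side, graded
commutativity of the singular cup product in even degree on the other). [cite: Kleiman1968, §1.4] [cite: VoisinHodgeI2002, §6.2.3]
[cite: HatcherAT2002, Thm. 3.11] -/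
theorem toComplexBetti_lefschetzPow {n : ℕ} {X : SchemeOver ℂ} (hX : IsSmoothProjective n X)
    (η : B.W.obj X 2) :
    ∀ (r : ℕ) ⦃i j : ℕ⦄ (h : i + 2 * r = j) (b : B.W.obj X i),
      B.toComplexBetti X j (B.W.lefschetzPow X η r i j h b) =
        lefschetzPowTo (B.toComplexBetti X 2 η) r i j h (B.toComplexBetti X i b)
  | 0, i, j, h, b => by
    obtain rfl : i = j := by omega
    rw [B.W.lefschetzPow_zero_apply hX η h b]
    rfl
  | r + 1, i, j, h, b => by
    have h₁ : i + 2 * r + 2 = j := by omega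
    have h₂ : 2 + (i + 2 * r) = j := by omega
    -- Weil side: `b ∪ η^{r+1} = (b ∪ ηʳ) ∪ η`
    have hW : B.W.lefschetzPow X η (r + 1) i j h b =
        B.W.cup h₁ (B.W.lefschetzPow X η r i (i + 2 * r) rfl b) η := by
      show B.W.cup h b (B.W.cup rfl (B.W.pow X η r) η) = B.W.cup h₁ (B.W.cup rfl b (B.W.pow X η r)) η
      rw [B.W.cup_assoc hX rfl rfl h₁ h]
    rw [hW, toComplexBetti_cup, toComplexBetti_lefschetzPow hX η r rfl b,
      lefschetzPowTo_succ_apply _ r i (i + 2 * r) j rfl h h₂, lefschetzOperator_apply,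
      cupProduct_gradedComm_holds ℂ (ComplexPoints X) h₁ h₂]
    rw [show ((-1 : ℂ) ^ ((i + 2 * r) * 2)) = 1 from
      (Nat.even_mul.mpr (Or.inr even_two)).neg_one_pow, one_smul]

/-! ## The complexified comparison of a hyperplane class has the hard Lefschetz property -/

variable {B} in
/-- **`Φ η` has the hard Lefschetz property in dimension `n = dim X ≥ 1`** for every `W`-hyperplane class `η` of a
smooth projective `X`: `η = e.ι^* cl_W(D)` with `D > 0` an effective divisor of `ℙᴺ`; `tr_X(ηⁿ) = deg X > 0`
(`trace_pow_of_isHyperplaneClass`) gives `η ≠ 0`, so `Φ(cl_W D) ≠ 0` spans the line `H²(ℙᴺ(ℂ); ℂ)` (`b₂(ℙᴺ) = 1`)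
and `Φ η = e.ι(ℂ)^* Φ(cl_W D)` is a non-zero multiple of the Kähler class of `X ⊂ ℙᴺ`, which has the hard
Lefschetz property (Voisin I Thm. 6.25; the tree's `hasHardLefschetzProperty_map_of_forall_eq_smul`). [cite: VoisinHodgeI2002, Thm. 6.25, Rem. 6.27 and Thm. 7.10] [cite: Kleiman1968, §1.4] -/
theorem hasHardLefschetzProperty_toComplexBetti {n : ℕ} {X : SchemeOver ℂ} (hX : IsSmoothProjective n X)
    (hn : 1 ≤ n) {η : B.W.obj X 2} (hη : B.W.IsHyperplaneClass X η) :
    HasHardLefschetzProperty (B.toComplexBetti X 2 η) n := by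
  obtain ⟨d, hd, htr⟩ := B.W.trace_pow_of_isHyperplaneClass hX η hη
  obtain ⟨e, D, hD, hD0, rfl⟩ := hη
  set c : B.W.obj (projectiveSpace e.n ℂ) 2 := B.W.cycleMap (projectiveSpace e.n ℂ) 1 D with hc
  -- `η ≠ 0` because `tr_X(ηⁿ) = d > 0` and `n ≥ 1`
  have hη0 : B.W.pullback e.ι 2 c ≠ 0 := by
    intro h0
    have hpow : B.W.pow X (B.W.pullback e.ι 2 c) n = 0 := by
      obtain ⟨m, rfl⟩ := Nat.exists_eq_succ_of_ne_zero (by omega : n ≠ 0)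
      rw [PreWeilCohomology.pow_succ, h0, map_zero]
    rw [hpow, map_zero] at htr
    exact hd.ne' (by exact_mod_cast htr.symm)
  -- hence `Φ c ≠ 0` spans the line `H²(ℙᴺ(ℂ); ℂ)`
  have hc0 : B.toComplexBetti (projectiveSpace e.n ℂ) 2 c ≠ 0 := by
    intro h0
    rw [BettiHodgeData.toComplexBetti_eq_zero_iff] at h0
    exact hη0 (by rw [h0, map_zero])
  obtain ⟨r₀, -, hgen⟩ := exists_isRationalClass_forall_eq_smul_projectiveSpace e.n
  obtain ⟨z₁, hz₁⟩ := hgen (B.toComplexBetti (projectiveSpace e.n ℂ) 2 c)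
  have hz₁0 : z₁ ≠ 0 := by
    rintro rfl
    exact hc0 (by rw [hz₁, zero_smul])
  have hgen' : ∀ c' : complexBetti (projectiveSpace e.n ℂ) 2,
      ∃ z : ℂ, c' = z • B.toComplexBetti (projectiveSpace e.n ℂ) 2 c := fun c' ↦ by
    obtain ⟨z, hz⟩ := hgen c'
    exact ⟨z / z₁, by rw [hz₁, smul_smul, div_mul_cancel₀ z hz₁0, hz]⟩
  -- Voisin I Thm. 6.25 for the Kähler class of `X ⊂ ℙᴺ`, moved to `e.ι(ℂ)^* Φ c = Φ η`
  have hHL := hasHardLefschetzProperty_map_of_forall_eq_smul hX e.ι hgen'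
  rwa [← toComplexBetti_pullback] at hHL

/-! ## Hard Lefschetz for `B.W` -/

/-- **Hard Lefschetz for the Weil cohomology of every Betti–Hodge realization datum over `ℂ`:** for `X` smooth
projective of dimension `n`, every `W`-hyperplane class `η` and `i + r = n`, `Lʳ : Hⁱ_W(X) → Hⁱ⁺²ʳ_W(X)` is
bijective. Injectivity for `r > 0` is transported from `H•(X(ℂ); ℂ)` along the injective, multiplicative, natural
comparison `Φ` (`toComplexBetti_lefschetzPow`, `hasHardLefschetzProperty_toComplexBetti`); it suffices by Poincaré
duality (`WeilCohomology.hasHardLefschetz_iff_injective_of_pos`). [cite: VoisinHodgeI2002, Thm. 6.25 and §7.1.2]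
[cite: Kleiman1968, §1.2 (A) and §1.4] -/
theorem hasHardLefschetz : B.W.HasHardLefschetz := by
  rw [WeilCohomology.hasHardLefschetz_iff_injective_of_pos]
  intro n X hX η hη i r j hr0 hir h b b' hbb'
  have hn : 1 ≤ n := by omega
  have key := congrArg (B.toComplexBetti X j) hbb'
  rw [toComplexBetti_lefschetzPow hX η r h b, toComplexBetti_lefschetzPow hX η r h b'] at key
  exact B.toComplexBetti_injective X i ((bijective_lefschetzPowTo_of_hasHardLefschetz _
    (hasHardLefschetzProperty_toComplexBetti hX hn hη) hir j h).1 key)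

end BettiHodgeData

end Literature.AlgebraicGeometry.Motives

end
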